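import Summits.HubbardSuperconductivity.HubbardSuperconductivity.Theorems.AnisotropyChordTransferFibre3TwoHoleBSNearInf

/-!
# Route `AnisotropyChord` / H0 rotor rung: the PERRON IDENTITY of the two-hole ℤ² skeleton — `P∞·1_B = 0` for EVERY offset with `|d|₁ ≥ 2`, from harmonicity alone; and the located obstruction it implies

Tenth file of the `TwoHoleBS` (PROP BS) chain (memo ROTOR-THEORY-21 §314(b) «Perron identity at Λ = ∞», §317(a)(i)–(iii),
§324(f) «structural null vector»).  `…Fibre3TwoHoleBSNearInf` reduced the near-pair HOLE₂(.75) tail for the pair `(z, z + d)`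
to three `L`-free facts about the explicit ℤ² skeleton `skelA d` (`p,q ↦ 2·a_∞(ipt p − ipt q)`), the third being a margin
inequality `ε₀·Ninf(w)² ≤ wᵀ·P∞·w` for the two-hole map at INFINITE capacity `P∞ = twoHolePinf (skelA d)`.  This file proves,
by FINITE ALGEBRA from the harmonicity of the ℤ² kernel (`Subsample.aZ2_harmonic`, no transcendental window value), that
`P∞` has the exact null vector `1_B` — the threshold resonance of the recurrent planar walk — and hence that the third fact is
unsatisfiable:
* `perron5`, `cluster_sum` (`Σ_i v_i·a_∞(r − clusterZ c i) = ½[r = c]` with `v = (−2, ½, ½, ½, ½)`), `perronV`, `oneZeta`,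
  `clusterZ_zero_eq_zero_iff`, `clusterZ_eq_self_iff`, `clusterZ_zero_ne`, `clusterZ_ne_zero`;
* ★ `skelA_mulVec_perronV`: `A·(½·1_B − 2·1_ζ) = 1_ζ` for every `|d|₁ ≥ 2`; `sum_perronV` (`Σv = 0`);
* for the invertible skeleton: `skelA_inv_mulVec_oneZeta` (`A⁻¹1_ζ = v`), `skelA_inv_isSymm`, ★ `xvec2_centre_sum`
  (`x_{ζ₁} + x_{ζ₂} = 1ᵀA⁻¹1_ζ = Σv = 0` for `x = A⁻¹1`), ★ `xvec2_emb_sum` (`x_B·1_B = s`), `xvec2_dot_pad`, `inv_emb_row_sum`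
  (`Σ_{j∈B}(A⁻¹)_{ij} = x_i − ½` on `B`);
* ★★ `twoHolePinf_mulVec_one`: **`P∞ · 1 = 0`** (`s ≠ 0`), `twoHolePinf_quad_one`;
* ★★ LOCATED OBSTRUCTION `near_inf_hpos_false`: for `s > 0` and any `ε₀ > 0` the hypothesis `∀ w, ε₀·Ninf(w)² ≤ wᵀP∞w` of
  `dualCert_threeQuarter_near_inf` / `_near_inf_sharp` / `_near_eventually` FAILS (`w = 1_B`: right side `0`, left side
  `≥ ε₀s²` by `svec2_le_Ninf_one`); with `errCoeff_pos` (`ε(L,d) > 0` for `L ≥ 8`, so `hε` forces `ε₀ > 0`) those three theorems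
  of p2 g2 are VACUOUS as stated — true, but with jointly unsatisfiable hypotheses for every `d`.  The finite-capacity forms
  `dualCert_threeQuarter_near{,_sharp}` / `dualCert_threeQuarter_of_tail` are unaffected: the rank-one lift
  `x_B x_Bᵀ/(s(Λs − 1))` carries the margin `≈ 1/(8Λ_L)` in the `1_B` direction (memo §317(b)); the honest replacement of
  `_near_eventually` is `…Fibre3TwoHoleBSMargin.dualCert_threeQuarter_near_eventually_of_gap` (next file).
Pure-python cross-check (prover's scratch `skel_check.py`, ℤ² kernel in `ℚ + ℚ/π` by the McCrea–Whipple march): for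
`d = (2,1),(3,0),(2,2),(3,1),(3,2),(3,3),(4,0),(4,1),(5,0),(6,1),(6,6)`: `|P∞1_B| ≤ 5·10⁻¹³`, `|Av − 1_ζ| ≤ 4·10⁻¹³`,
`s = 1.5156, 1.4352, 1.4517, 1.4211, …`, next eigenvalue `g₀(d) = .6031, .5632, .5755, .5521, .5260, .4900, .5028, .4962, .4543, .4143, .3562`
(memo §317(a)(iii)/(iv) values reproduced).
Prover seat `hubbard-h0-rotor-p2` g3; helper for stmt-HubbardSuperconductivity-19089 (`--supports`, helper class).
WHAT THIS IS NOT: nothing here proves superconductivity in the Hubbard model; the rotor TARGET as originally worded stays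
FALSE (g15 verdict).  This is structure of ONE input (HOLE₂(.75), near-pair tail) of ONE conditional reduction (rung 19089);
it certifies no pair by itself.  Mathlib + tree imports only; no sorry, no axioms.
-/

set_option linter.dupNamespace false

noncomputable section

open scoped BigOperators
open Complex Finset

namespace Summit.HubbardSuperconductivity.HubbardSuperconductivity.Theorems.AnisotropyChord.Transfer.Fibre3

namespace TwoHoleBS

/-! ## The Perron test vector and the cluster sum identity -/

/-- the one-cluster Perron weights: `−2` at the centre, `½` on the four cross points. [folklore] -/
def perron5 : Fin 5 → ℝ := ![-2, 1 / 2, 1 / 2, 1 / 2, 1 / 2]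

/-- ★ CLUSTER SUM IDENTITY (harmonicity of `a_∞` packaged): for every `r, c ∈ ℤ²`,
`Σ_i perron5 i · a_∞(r − clusterZ c i) = −2a_∞(r − c) + ½Σ_e a_∞(r − c − e) = ½·[r = c]`. [folklore] -/
theorem cluster_sum (r c : ℤ × ℤ) :
    ∑ i : Fin 5, perron5 i * Subsample.aZ2 (r - clusterZ c i).1 (r - clusterZ c i).2
      = if r = c then (1 / 2 : ℝ) else 0 := by
  have h := Subsample.aZ2_harmonic (r.1 - c.1) (r.2 - c.2)
  rw [Fin.sum_univ_five]
  simp only [perron5, clusterZ, Matrix.cons_val_zero, Matrix.cons_val_one, Matrix.head_cons,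
    Matrix.cons_val_two, Matrix.tail_cons, Matrix.cons_val_three, Matrix.cons_val_four,
    Prod.fst_sub, Prod.snd_sub, Prod.fst_add, Prod.snd_add]
  have e1 : r.1 - (c.1 + 1) = r.1 - c.1 - 1 := by ring
  have e2 : r.1 - (c.1 + -1) = r.1 - c.1 + 1 := by ring
  have e3 : r.2 - (c.2 + 1) = r.2 - c.2 - 1 := by ring
  have e4 : r.2 - (c.2 + -1) = r.2 - c.2 + 1 := by ring
  have e5 : r.2 - (c.2 + 0) = r.2 - c.2 := by ring
  have e6 : r.1 - (c.1 + 0) = r.1 - c.1 := by ring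
  simp only [e1, e2, e3, e4, e5, e6]
  have hrc : (r = c) ↔ (r.1 - c.1 = 0 ∧ r.2 - c.2 = 0) := by
    rw [Prod.ext_iff, sub_eq_zero, sub_eq_zero]
  by_cases hq : r = c
  · rw [if_pos hq]
    rw [if_pos (hrc.mp hq)] at h
    linarith
  · rw [if_neg hq]
    rw [if_neg (fun h' => hq (hrc.mpr h'))] at h
    linarith

/-- the ten-slot Perron test vector `v = ½·1_B − 2·1_ζ` (`−2` at the two centres, `½` on the eight cross slots). [folklore] -/
def perronV : Fin 5 ⊕ Fin 5 → ℝ := Sum.elim perron5 perron5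

/-- the indicator of the two centre slots, `1_ζ`. [folklore] -/
def oneZeta : Fin 5 ⊕ Fin 5 → ℝ := Sum.elim ![1, 0, 0, 0, 0] ![1, 0, 0, 0, 0]

/-- `clusterZ 0 i = 0 ↔ i = 0`. [folklore] -/
theorem clusterZ_zero_eq_zero_iff (i : Fin 5) : clusterZ 0 i = 0 ↔ i = 0 := by
  fin_cases i <;> simp [clusterZ, Prod.ext_iff]

/-- `clusterZ c i = c ↔ i = 0`. [folklore] -/
theorem clusterZ_eq_self_iff (c : ℤ × ℤ) (i : Fin 5) : clusterZ c i = c ↔ i = 0 := by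
  rw [clusterZ_eq_add c i, add_eq_left, clusterZ_zero_eq_zero_iff]

/-- for `|d|₁ ≥ 2` no cross point of the origin cluster is `d`. [folklore] -/
theorem clusterZ_zero_ne (d : ℤ × ℤ) (hd : 2 ≤ |d.1| + |d.2|) (i : Fin 5) : clusterZ 0 i ≠ d := by
  intro h
  have h1 := congrArg Prod.fst h
  have h2 := congrArg Prod.snd h
  fin_cases i <;> simp [clusterZ] at h1 h2 <;> rw [← h1, ← h2] at hd <;> norm_num at hd

/-- for `|d|₁ ≥ 2` no point of the `d`-cluster is the origin. [folklore] -/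
theorem clusterZ_ne_zero (d : ℤ × ℤ) (hd : 2 ≤ |d.1| + |d.2|) (i : Fin 5) : clusterZ d i ≠ 0 := by
  intro h
  have h1 := congrArg Prod.fst h
  have h2 := congrArg Prod.snd h
  fin_cases i <;> simp [clusterZ] at h1 h2 <;>
    [skip; (rw [add_eq_zero_iff_eq_neg] at h1); (rw [add_eq_zero_iff_eq_neg] at h1);
      (rw [add_eq_zero_iff_eq_neg] at h2); (rw [add_eq_zero_iff_eq_neg] at h2)] <;>
    simp only [h1, h2] at hd <;> norm_num at hd

/-- ★ **`A·v = 1_ζ`:** for every offset with `|d|₁ ≥ 2` the skeleton kernel matrix maps the Perron test vector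
`v = ½·1_B − 2·1_ζ` to the indicator of the centres (two instances of `cluster_sum` per row). [folklore] -/
theorem skelA_mulVec_perronV (d : ℤ × ℤ) (hd : 2 ≤ |d.1| + |d.2|) :
    (skelA d).mulVec perronV = oneZeta := by
  have hd0 : d ≠ 0 := by
    rintro rfl
    simp at hd
  funext p
  simp only [Matrix.mulVec, dotProduct]
  rw [Fintype.sum_sum_type]
  simp only [skelA, Matrix.of_apply, ipt, Sum.elim_inl, Sum.elim_inr, perronV]
  have key : ∀ c : ℤ × ℤ, ∑ i : Fin 5, 2 * Subsample.aZ2 (Sum.elim (clusterZ 0) (clusterZ d) p - clusterZ c i).1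
      (Sum.elim (clusterZ 0) (clusterZ d) p - clusterZ c i).2 * perron5 i
      = if Sum.elim (clusterZ 0) (clusterZ d) p = c then (1 : ℝ) else 0 := by
    intro c
    have h := cluster_sum (Sum.elim (clusterZ 0) (clusterZ d) p) c
    rw [show (∑ i : Fin 5, 2 * Subsample.aZ2 (Sum.elim (clusterZ 0) (clusterZ d) p - clusterZ c i).1
        (Sum.elim (clusterZ 0) (clusterZ d) p - clusterZ c i).2 * perron5 i)
        = 2 * ∑ i : Fin 5, perron5 i * Subsample.aZ2 (Sum.elim (clusterZ 0) (clusterZ d) p - clusterZ c i).1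
          (Sum.elim (clusterZ 0) (clusterZ d) p - clusterZ c i).2 by
      rw [Finset.mul_sum]; exact Finset.sum_congr rfl fun i _ => by ring, h]
    split_ifs <;> norm_num
  rw [key 0, key d]
  rcases p with i | i
  · simp only [Sum.elim_inl, oneZeta]
    rw [if_neg (clusterZ_zero_ne d hd i), add_zero]
    by_cases hi : i = 0
    · subst hi; simp [clusterZ]
    · rw [if_neg (fun h => hi ((clusterZ_zero_eq_zero_iff i).mp h))]
      fin_cases i <;> simp at hi ⊢
  · simp only [Sum.elim_inr, oneZeta]
    rw [if_neg (clusterZ_ne_zero d hd i), zero_add]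
    by_cases hi : i = 0
    · subst hi; simp [clusterZ]
    · rw [if_neg (fun h => hi ((clusterZ_eq_self_iff d i).mp h))]
      fin_cases i <;> simp at hi ⊢

/-- `Σ_p v_p = 8·½ − 2·2 = 0`. [folklore] -/
theorem sum_perronV : ∑ p : Fin 5 ⊕ Fin 5, perronV p = 0 := by
  rw [Fintype.sum_sum_type]
  simp only [perronV, Sum.elim_inl, Sum.elim_inr, Fin.sum_univ_five, perron5]
  simp
  norm_num

/-- `1_ζ` vanishes on the boundary slots. [folklore] -/
theorem oneZeta_emb (i : Fin 4 ⊕ Fin 4) : oneZeta (TwoChannel.emb i) = 0 := by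
  rcases i with i | i <;> fin_cases i <;> simp [oneZeta, TwoChannel.emb]

/-- `v = ½` on the boundary slots. [folklore] -/
theorem perronV_emb (i : Fin 4 ⊕ Fin 4) : perronV (TwoChannel.emb i) = 1 / 2 := by
  rcases i with i | i <;> simp [perronV, perron5, TwoChannel.emb] <;> fin_cases i <;> simp

/-- `1 = pad 1 + 1_ζ` on the ten slots. [folklore] -/
theorem one_eq_pad_add_oneZeta : (fun _ : Fin 5 ⊕ Fin 5 => (1 : ℝ)) = pad (fun _ => 1) + oneZeta := by
  funext p
  rcases p with i | i <;> fin_cases i <;> simp [pad, oneZeta] <;> rfl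

/-! ## Consequences for the invertible skeleton: `A⁻¹1_ζ = v`, the harmonic-measure vector has zero centre sum, `x_B·1_B = s` -/

/-- `A⁻¹ 1_ζ = v`. [folklore] -/
theorem skelA_inv_mulVec_oneZeta (d : ℤ × ℤ) (hd : 2 ≤ |d.1| + |d.2|) (hA : IsUnit (skelA d).det) :
    (skelA d)⁻¹.mulVec oneZeta = perronV := by
  rw [← skelA_mulVec_perronV d hd, Matrix.mulVec_mulVec, Matrix.nonsing_inv_mul _ hA, Matrix.one_mulVec]

/-- the inverse of the (symmetric) skeleton is symmetric. [folklore] -/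
theorem skelA_inv_isSymm (d : ℤ × ℤ) : ((skelA d)⁻¹).IsSymm := by
  have hs := skelA_isSymm d
  unfold Matrix.IsSymm at *
  rw [Matrix.transpose_nonsing_inv, hs]

/-- ★ the harmonic-measure vector `x = A⁻¹1` has ZERO CENTRE SUM: `x_{ζ,1} + x_{ζ,2} = 1ᵀA⁻¹1_ζ = Σ_p v_p = 0`. [folklore] -/
theorem xvec2_centre_sum (d : ℤ × ℤ) (hd : 2 ≤ |d.1| + |d.2|) (hA : IsUnit (skelA d).det) :
    TwoChannel.xvec2 (skelA d) (Sum.inl 0) + TwoChannel.xvec2 (skelA d) (Sum.inr 0) = 0 := by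
  have h1 : TwoChannel.xvec2 (skelA d) (Sum.inl 0) + TwoChannel.xvec2 (skelA d) (Sum.inr 0)
      = dotProduct oneZeta (TwoChannel.xvec2 (skelA d)) := by
    simp only [dotProduct, Fintype.sum_sum_type, oneZeta, Sum.elim_inl, Sum.elim_inr, Fin.sum_univ_five]
    simp
  rw [h1, TwoChannel.xvec2, Matrix.dotProduct_mulVec, ← Matrix.mulVec_transpose, (skelA_inv_isSymm d).eq,
    skelA_inv_mulVec_oneZeta d hd hA]
  simp only [dotProduct, mul_one]
  exact sum_perronV

/-- ★ `x_B · 1_B = s` (the boundary part of `x` carries the whole of `s = Σx`). [folklore] -/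
theorem xvec2_emb_sum (d : ℤ × ℤ) (hd : 2 ≤ |d.1| + |d.2|) (hA : IsUnit (skelA d).det) :
    ∑ i : Fin 4 ⊕ Fin 4, TwoChannel.xvec2 (skelA d) (TwoChannel.emb i) = TwoChannel.svec2 (skelA d) := by
  have h := xvec2_centre_sum d hd hA
  unfold TwoChannel.svec2
  rw [Fintype.sum_sum_type, Fintype.sum_sum_type,
    Fin.sum_univ_succ (f := fun i : Fin 5 => TwoChannel.xvec2 (skelA d) (Sum.inl i)),
    Fin.sum_univ_succ (f := fun i : Fin 5 => TwoChannel.xvec2 (skelA d) (Sum.inr i))]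
  simp only [TwoChannel.emb, Sum.map_inl, Sum.map_inr]
  linarith

/-- `x · pad w = x_B · w`. [folklore] -/
theorem xvec2_dot_pad (A : Matrix (Fin 5 ⊕ Fin 5) (Fin 5 ⊕ Fin 5) ℝ) (w : Fin 4 ⊕ Fin 4 → ℝ) :
    ∑ q, TwoChannel.xvec2 A q * pad w q = ∑ i : Fin 4 ⊕ Fin 4, TwoChannel.xvec2 A (TwoChannel.emb i) * w i := by
  rw [sum_eq_sum_emb_real (F := fun q => TwoChannel.xvec2 A q * pad w q) (by simp [(pad_centre w).1])
    (by simp [(pad_centre w).2])]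
  simp only [pad_emb]

/-! ## ★ The Perron identity `P∞ · 1_B = 0` (threshold resonance of the recurrent ℤ² walk, as finite algebra) -/

/-- boundary row sums of `A⁻¹`: `Σ_j (A⁻¹)_{emb i, emb j} = x_{emb i} − ½`. [folklore] -/
theorem inv_emb_row_sum (d : ℤ × ℤ) (hd : 2 ≤ |d.1| + |d.2|) (hA : IsUnit (skelA d).det) (i : Fin 4 ⊕ Fin 4) :
    ∑ j : Fin 4 ⊕ Fin 4, (skelA d)⁻¹ (TwoChannel.emb i) (TwoChannel.emb j)
      = TwoChannel.xvec2 (skelA d) (TwoChannel.emb i) - 1 / 2 := by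
  have hx : TwoChannel.xvec2 (skelA d) (TwoChannel.emb i) = ∑ q, (skelA d)⁻¹ (TwoChannel.emb i) q := by
    simp [TwoChannel.xvec2, Matrix.mulVec, dotProduct]
  have hv : ((skelA d)⁻¹.mulVec oneZeta) (TwoChannel.emb i) = 1 / 2 := by
    rw [skelA_inv_mulVec_oneZeta d hd hA, perronV_emb]
  simp only [Matrix.mulVec, dotProduct] at hv
  have hsplit : ∑ q, (skelA d)⁻¹ (TwoChannel.emb i) q
      = ∑ q, (skelA d)⁻¹ (TwoChannel.emb i) q * pad (fun _ => 1) q + ∑ q, (skelA d)⁻¹ (TwoChannel.emb i) q * oneZeta q := by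
    rw [← Finset.sum_add_distrib]
    refine Finset.sum_congr rfl fun q _ => ?_
    have := congrFun one_eq_pad_add_oneZeta q
    simp only [Pi.add_apply] at this
    rw [← mul_add, ← this, mul_one]
  have hpad : ∑ q, (skelA d)⁻¹ (TwoChannel.emb i) q * pad (fun _ => 1) q
      = ∑ j : Fin 4 ⊕ Fin 4, (skelA d)⁻¹ (TwoChannel.emb i) (TwoChannel.emb j) := by
    rw [sum_eq_sum_emb_real (F := fun q => (skelA d)⁻¹ (TwoChannel.emb i) q * pad (fun _ => 1) q)
      (by simp [(pad_centre (fun _ => (1:ℝ))).1]) (by simp [(pad_centre (fun _ => (1:ℝ))).2])]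
    simp only [pad_emb, mul_one]
  rw [hx, hsplit, hpad, hv]
  ring

/-- ★★ **PERRON IDENTITY:** for every offset with `|d|₁ ≥ 2`, invertible skeleton and `s ≠ 0`, the two-hole map at infinite
capacity annihilates the constant boundary vector: `twoHolePinf (skelA d) · 1 = 0` — the exact null vector behind the
`κ/Λ` margin law (memo 21 §314(b), §317(a)(iii)); here a FINITE consequence of `aZ2_harmonic`, no transcendental input. [folklore] -/
theorem twoHolePinf_mulVec_one (d : ℤ × ℤ) (hd : 2 ≤ |d.1| + |d.2|) (hA : IsUnit (skelA d).det)
    (hs : TwoChannel.svec2 (skelA d) ≠ 0) :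
    (twoHolePinf (skelA d)).mulVec (fun _ => (1 : ℝ)) = 0 := by
  funext i
  simp only [Matrix.mulVec, dotProduct, twoHolePinf, Matrix.of_apply, mul_one, Pi.zero_apply]
  rw [Finset.sum_sub_distrib, Finset.sum_add_distrib, Finset.sum_neg_distrib, inv_emb_row_sum d hd hA i,
    Finset.sum_ite_eq, if_pos (Finset.mem_univ _)]
  have hxs : ∑ j : Fin 4 ⊕ Fin 4, TwoChannel.xvec2 (skelA d) (TwoChannel.emb i) * TwoChannel.xvec2 (skelA d) (TwoChannel.emb j)
      / TwoChannel.svec2 (skelA d) = TwoChannel.xvec2 (skelA d) (TwoChannel.emb i) := by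
    rw [← Finset.sum_div, ← Finset.mul_sum, xvec2_emb_sum d hd hA]
    field_simp
  rw [hxs]
  ring

/-- the quadratic form of `P∞` vanishes on the constant vector. [folklore] -/
theorem twoHolePinf_quad_one (d : ℤ × ℤ) (hd : 2 ≤ |d.1| + |d.2|) (hA : IsUnit (skelA d).det)
    (hs : TwoChannel.svec2 (skelA d) ≠ 0) :
    dotProduct (fun _ => (1 : ℝ)) ((twoHolePinf (skelA d)).mulVec fun _ => (1 : ℝ)) = 0 := by
  rw [twoHolePinf_mulVec_one d hd hA hs, dotProduct_zero]

/-! ## ★ LOCATED OBSTRUCTION: the `L`-free margin hypothesis of `dualCert_threeQuarter_near_inf` is unsatisfiable -/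

/-- `Ninf(1) ≥ s`: the charge norm majorant of the constant boundary vector is at least `Σ_p|x_p| ≥ s`. [folklore] -/
theorem svec2_le_Ninf_one (d : ℤ × ℤ) (hd : 2 ≤ |d.1| + |d.2|) (hA : IsUnit (skelA d).det)
    (hs : 0 < TwoChannel.svec2 (skelA d)) :
    TwoChannel.svec2 (skelA d) ≤ Ninf (skelA d) (fun _ => 1) := by
  unfold Ninf
  have hdot : ∑ q, TwoChannel.xvec2 (skelA d) q * pad (fun _ => (1 : ℝ)) q = TwoChannel.svec2 (skelA d) := by
    rw [xvec2_dot_pad]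
    simp only [mul_one]
    exact xvec2_emb_sum d hd hA
  rw [hdot, abs_of_pos hs]
  have e : TwoChannel.svec2 (skelA d) * (∑ p, |TwoChannel.xvec2 (skelA d) p|) / TwoChannel.svec2 (skelA d)
      = ∑ p, |TwoChannel.xvec2 (skelA d) p| := mul_div_cancel_left₀ _ hs.ne'
  rw [e]
  have h1 : TwoChannel.svec2 (skelA d) ≤ ∑ p, |TwoChannel.xvec2 (skelA d) p| := by
    unfold TwoChannel.svec2
    exact (le_abs_self _).trans (Finset.abs_sum_le_sum_abs _ _)
  have h2 : 0 ≤ ∑ p, |(smInvInf (skelA d)).mulVec (pad fun _ => (1 : ℝ)) p| :=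
    Finset.sum_nonneg fun p _ => abs_nonneg _
  linarith

/-- ★★ **THE `L`-FREE MARGIN HYPOTHESIS IS UNSATISFIABLE:** for `|d|₁ ≥ 2`, invertible skeleton with `s > 0` and any
`ε₀ > 0`, the hypothesis `∀ w, ε₀·Ninf(w)² ≤ wᵀ·P∞·w` of `dualCert_threeQuarter_near_inf` (and `_near_inf_sharp`,
`_near_eventually`) FAILS at `w = 1_B` (right side `0` by the Perron identity, left side `≥ ε₀s² > 0`).  Those theorems are
therefore vacuous as stated; the finite-capacity forms `dualCert_threeQuarter_near{,_sharp}` are the ones to instantiate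
(the rank-one lift `x_B x_Bᵀ/(s(Λs−1))` carries the margin in the `1_B` direction, memo §317(b)). [folklore] -/
theorem near_inf_hpos_false (d : ℤ × ℤ) (hd : 2 ≤ |d.1| + |d.2|) (hA : IsUnit (skelA d).det)
    (hs : 0 < TwoChannel.svec2 (skelA d)) {ε₀ : ℝ} (hε₀ : 0 < ε₀) :
    ¬ (∀ w : Fin 4 ⊕ Fin 4 → ℝ,
        ε₀ * (Ninf (skelA d) w) ^ 2 ≤ dotProduct w ((twoHolePinf (skelA d)).mulVec w)) := by
  intro h
  have h1 := h (fun _ => 1)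
  rw [twoHolePinf_quad_one d hd hA hs.ne'] at h1
  have h2 := svec2_le_Ninf_one d hd hA hs
  have h3 : 0 < (Ninf (skelA d) (fun _ => 1)) ^ 2 := by
    have : 0 < Ninf (skelA d) (fun _ => 1) := lt_of_lt_of_le hs h2
    positivity
  have := mul_pos hε₀ h3
  linarith

/-- for `8 ≤ L` the error coefficient `ε(L, d)` is positive, so `hε : ε(L,d) ≤ ε₀` forces `ε₀ > 0`: together with
`near_inf_hpos_false`, the hypotheses `hε`, `hpos` of `dualCert_threeQuarter_near_inf` are jointly unsatisfiable. [folklore] -/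
theorem errCoeff_pos (L : ℕ) (hL : 8 ≤ L) (d : ℤ × ℤ) :
    0 < 2 * (rhoMax d * (11.71 * Real.log L + 5.9) / (L : ℝ) ^ 2)
      + 4 * (((15 / 2 * (Real.pi ^ 2 / 2 + Real.pi ^ 4 / 4) + 3 * Real.pi ^ 2 / 16)) * rhoMax d) / L := by
  have hL1 : (1 : ℝ) ≤ L := by exact_mod_cast (show 1 ≤ L by omega)
  have hlog : 0 ≤ Real.log L := Real.log_nonneg hL1
  have hρ : 0 < rhoMax d := by
    unfold rhoMax
    have h1 : (0 : ℝ) ≤ ((|d.1| : ℤ) : ℝ) := by exact_mod_cast abs_nonneg d.1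
    have h2 : (0 : ℝ) ≤ ((|d.2| : ℤ) : ℝ) := by exact_mod_cast abs_nonneg d.2
    nlinarith
  positivity

end TwoHoleBS

end Summit.HubbardSuperconductivity.HubbardSuperconductivity.Theorems.AnisotropyChord.Transfer.Fibre3

end
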